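import Mathlib
import Literature.Analysis.Calculus.PolarCoordinatesE3
import HarnessLib

/-!
# R52 §D: THE RADIAL CAPACITY LEMMA (plate t55-RC)
# (nsreg-p2 ROUND-52 «PROVENANCE» v1.2 bca60ece7b3dcb40, `r52/Sketch52.v1.2.lean` 60bfd4b645ab26b0 §D l.265–275:
# `theorem radialCapacity : NsregP2.R52.Provenance.RadialCapacity` — the `def … : Prop` VERBATIM, unfolded, as the theorem's type;
# seat ns-sfl-p1 g9, `--supports stmt-NavierStokesRegularity-19832 --as helper`)

**RADIAL CAPACITY LEMMA** (class-free, symmetrization-free).  If `V ∈ C¹(ℝ³, ℝ³)`, `‖V‖ ≥ m > 0` on `B̄(y₀, ℓ)`, `0 < ℓ`, `2ℓ ≤ L`, then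
`∫_{B(y₀,L)} ‖DV‖² ≥ m²·ℓ·(π − vol{y ∈ B(y₀,L) : m/2 ≤ ‖V y‖}/L³)`.
Proof (polar coordinates about `y₀`, `Literature.Analysis.Calculus.lintegral_eq_lintegral_sphere_Ioi`): along each direction `θ ∈ S²`
either `‖V(y₀ + rθ)‖ ≥ m/2` for all `r ∈ [ℓ, L)` — these BAD directions fill volume `≥ σ(Θ_bad)·(L³ − ℓ³)/3 ≥ σ(Θ_bad)·L³/4` of the
level set — or `‖V‖` drops by `m/2` on `[ℓ, r_θ]`, and then `m/2 ≤ ∫_ℓ^{r_θ} ‖DV‖ dr ≤ X/(mℓ) + (mℓ/4)∫_ℓ^{r_θ} dr/r² ≤ X/(mℓ) + m/4`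
(`2ab ≤ a² + b²`, `|∂_r V| ≤ ‖DV‖` in operator norm) gives `X = ∫_ℓ^{r_θ} ‖DV(y₀+rθ)‖² r² dr ≥ m²ℓ/4` (`ray_energy_lower_bound`);
integrating over the good directions (`σ(S²) = 4π`) yields the claim.

HONEST FRAMING: a class-free calculus lemma (the instrument behind ROUND-52's fat-core exclusion for hypothetical self-similar Euler
profiles); nothing about the crux E (19832 OPEN) or NS regularity is proved here. [nsreg-p2 R52 §D; folklore (radial length–energy)]
-/

noncomputable section

set_option linter.dupNamespace false

open Set Filter Topology Metric Function MeasureTheory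
open scoped Topology ENNReal

namespace Summit.NavierStokesRegularity.NavierStokesRegularity.Theorems.PowerGaugeEulerLiouville

namespace Capacity

/-! ## The ray lemma -/

/-- The ray `r ↦ y₀ + r•ω` has velocity `ω`. [folklore] -/
theorem hasDerivAt_ray (y₀ ω : EuclideanSpace ℝ (Fin 3)) (r : ℝ) :
    HasDerivAt (fun t : ℝ => y₀ + t • ω) ω r := by
  simpa using ((hasDerivAt_id r).smul_const ω).const_add y₀

/-- **Ray energy lower bound** (length–energy along one direction).  If `V ∈ C¹`, `‖ω‖ = 1`, `0 < ℓ ≤ r₁`, `‖V(y₀ + ℓω)‖ ≥ m > 0` and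
`‖V(y₀ + r₁ω)‖ ≤ m/2`, then `∫_ℓ^{r₁} ‖DV(y₀ + rω)‖²·r² dr ≥ m²ℓ/4`: the drop `m/2 ≤ ∫_ℓ^{r₁} ‖DV‖` is priced by
`‖DV‖ ≤ ‖DV‖²r²/(mℓ) + mℓ/(4r²)` and `∫_ℓ^{r₁} dr/r² ≤ 1/ℓ`. [folklore] -/
theorem ray_energy_lower_bound {V : EuclideanSpace ℝ (Fin 3) → EuclideanSpace ℝ (Fin 3)} (hV : ContDiff ℝ 1 V)
    (y₀ ω : EuclideanSpace ℝ (Fin 3)) (hω : ‖ω‖ = 1) {m ℓ r₁ : ℝ} (hm : 0 < m) (hℓ : 0 < ℓ) (hr₁ : ℓ ≤ r₁)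
    (h0 : m ≤ ‖V (y₀ + ℓ • ω)‖) (h1 : ‖V (y₀ + r₁ • ω)‖ ≤ m / 2) :
    m ^ 2 * ℓ / 4 ≤ ∫ r in ℓ..r₁, ‖fderiv ℝ V (y₀ + r • ω)‖ ^ 2 * r ^ 2 := by
  have hVd : Differentiable ℝ V := hV.differentiable one_ne_zero
  have hray : Continuous fun t : ℝ => y₀ + t • ω := by fun_prop
  have hDVc : Continuous fun t : ℝ => fderiv ℝ V (y₀ + t • ω) := (hV.continuous_fderiv one_ne_zero).comp hray
  set D : ℝ → ℝ := fun t => ‖fderiv ℝ V (y₀ + t • ω)‖ with hD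
  have hDc : Continuous D := hDVc.norm
  -- the curve `φ(t) = V(y₀ + tω)` and its derivative `DV(y₀ + tω) ω`
  have hφ : ∀ t, HasDerivAt (fun t : ℝ => V (y₀ + t • ω)) (fderiv ℝ V (y₀ + t • ω) ω) t := fun t =>
    (hVd _).hasFDerivAt.comp_hasDerivAt t (hasDerivAt_ray y₀ ω t)
  have hφ'c : Continuous fun t : ℝ => fderiv ℝ V (y₀ + t • ω) ω := hDVc.clm_apply continuous_const
  have hφ'le : ∀ t, ‖fderiv ℝ V (y₀ + t • ω) ω‖ ≤ D t := fun t => by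
    simpa [hD, hω] using (fderiv ℝ V (y₀ + t • ω)).le_opNorm ω
  -- step 1: the drop `m/2 ≤ ∫_ℓ^{r₁} ‖DV‖`
  have hFTC : ∫ t in ℓ..r₁, fderiv ℝ V (y₀ + t • ω) ω = V (y₀ + r₁ • ω) - V (y₀ + ℓ • ω) :=
    intervalIntegral.integral_eq_sub_of_hasDerivAt (fun t _ => hφ t) (hφ'c.intervalIntegrable _ _)
  have step1 : m / 2 ≤ ∫ t in ℓ..r₁, D t := by
    have hdrop : m / 2 ≤ ‖V (y₀ + r₁ • ω) - V (y₀ + ℓ • ω)‖ := by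
      have := norm_sub_norm_le (V (y₀ + ℓ • ω)) (V (y₀ + r₁ • ω))
      rw [norm_sub_rev] at this
      linarith
    calc m / 2 ≤ ‖V (y₀ + r₁ • ω) - V (y₀ + ℓ • ω)‖ := hdrop
      _ = ‖∫ t in ℓ..r₁, fderiv ℝ V (y₀ + t • ω) ω‖ := by rw [hFTC]
      _ ≤ ∫ t in ℓ..r₁, ‖fderiv ℝ V (y₀ + t • ω) ω‖ := intervalIntegral.norm_integral_le_integral_norm hr₁
      _ ≤ ∫ t in ℓ..r₁, D t :=
          intervalIntegral.integral_mono_on hr₁ (hφ'c.norm.intervalIntegrable _ _) (hDc.intervalIntegrable _ _)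
            (fun t _ => hφ'le t)
  -- step 2: `D ≤ D²r²/(mℓ) + (mℓ/4)/r²` on `[ℓ, r₁]`, integrated
  have hml : 0 < m * ℓ := mul_pos hm hℓ
  have hptw : ∀ t ∈ Icc ℓ r₁, D t ≤ (m * ℓ)⁻¹ * (D t ^ 2 * t ^ 2) + (m * ℓ / 4) * (t ^ 2)⁻¹ := by
    intro t ht
    have ht0 : 0 < t := lt_of_lt_of_le hℓ ht.1
    have ht2 : 0 < t ^ 2 := by positivity
    have hD0 : 0 ≤ D t := norm_nonneg _
    have key : 0 ≤ (2 * D t * t ^ 2 - m * ℓ) ^ 2 := sq_nonneg _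
    rw [← sub_nonneg]
    have e : (m * ℓ)⁻¹ * (D t ^ 2 * t ^ 2) + m * ℓ / 4 * (t ^ 2)⁻¹ - D t =
        (2 * D t * t ^ 2 - m * ℓ) ^ 2 / (4 * (m * ℓ) * t ^ 2) := by
      field_simp
      ring
    rw [e]
    positivity
  have hinvc : ContinuousOn (fun t : ℝ => (t ^ 2)⁻¹) (uIcc ℓ r₁) := by
    refine (continuousOn_pow 2).inv₀ fun t ht => ?_
    rw [uIcc_of_le hr₁] at ht
    exact pow_ne_zero _ (lt_of_lt_of_le hℓ ht.1).ne'
  have hinvi : IntervalIntegrable (fun t : ℝ => (t ^ 2)⁻¹) volume ℓ r₁ := hinvc.intervalIntegrable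
  have hD2c : Continuous fun t => D t ^ 2 * t ^ 2 := by fun_prop
  have hinv_int : ∫ t in ℓ..r₁, (t ^ 2)⁻¹ = ℓ⁻¹ - r₁⁻¹ := by
    have h : ∀ t ∈ uIcc ℓ r₁, HasDerivAt (fun t : ℝ => -t⁻¹) ((t ^ 2)⁻¹) t := by
      intro t ht
      rw [uIcc_of_le hr₁] at ht
      have ht0 : t ≠ 0 := (lt_of_lt_of_le hℓ ht.1).ne'
      simpa [Pi.neg_def] using (hasDerivAt_inv ht0).neg
    rw [intervalIntegral.integral_eq_sub_of_hasDerivAt h hinvi]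
    ring
  have step2 : ∫ t in ℓ..r₁, D t ≤
      (m * ℓ)⁻¹ * (∫ t in ℓ..r₁, D t ^ 2 * t ^ 2) + (m * ℓ / 4) * (ℓ⁻¹ - r₁⁻¹) := by
    calc ∫ t in ℓ..r₁, D t
        ≤ ∫ t in ℓ..r₁, ((m * ℓ)⁻¹ * (D t ^ 2 * t ^ 2) + (m * ℓ / 4) * (t ^ 2)⁻¹) :=
          intervalIntegral.integral_mono_on hr₁ (hDc.intervalIntegrable _ _)
            (((hD2c.intervalIntegrable _ _).const_mul _).add (hinvi.const_mul _)) hptw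
      _ = (m * ℓ)⁻¹ * (∫ t in ℓ..r₁, D t ^ 2 * t ^ 2) + (m * ℓ / 4) * (ℓ⁻¹ - r₁⁻¹) := by
          rw [intervalIntegral.integral_add ((hD2c.intervalIntegrable _ _).const_mul _) (hinvi.const_mul _),
            intervalIntegral.integral_const_mul, intervalIntegral.integral_const_mul, hinv_int]
  -- step 3: arithmetic
  set X := ∫ t in ℓ..r₁, D t ^ 2 * t ^ 2 with hX
  have hr₁0 : 0 < r₁ := lt_of_lt_of_le hℓ hr₁
  have htail : (m * ℓ / 4) * (ℓ⁻¹ - r₁⁻¹) ≤ m / 4 := by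
    have e : (m * ℓ / 4) * ℓ⁻¹ = m / 4 := by field_simp
    have : 0 ≤ (m * ℓ / 4) * r₁⁻¹ := by positivity
    nlinarith
  have hmain : m / 4 ≤ (m * ℓ)⁻¹ * X := by linarith
  rw [inv_mul_eq_div, le_div_iff₀ hml] at hmain
  linarith


/-! ## Polar coordinates about a centre -/

/-- **Polar coordinates about `y₀` on a ball**: `∫_{B(y₀,L)} F = ∫_{S²} dσ(ω) ∫_0^L F(y₀ + rω) r² dr` for measurable `F : ℝ³ → [0,∞]`,
`σ = volume.toSphere` (translation invariance + `Literature.Analysis.Calculus.lintegral_eq_lintegral_sphere_Ioi`). [folklore] -/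
theorem lintegral_ball_eq_lintegral_sphere (F : EuclideanSpace ℝ (Fin 3) → ℝ≥0∞) (hF : Measurable F)
    (y₀ : EuclideanSpace ℝ (Fin 3)) (L : ℝ) :
    ∫⁻ y in ball y₀ L, F y =
      ∫⁻ ω : sphere (0 : EuclideanSpace ℝ (Fin 3)) 1,
        (∫⁻ r in Ioo 0 L, F (y₀ + r • (ω : EuclideanSpace ℝ (Fin 3))) * ENNReal.ofReal (r ^ 2))
          ∂(volume : Measure (EuclideanSpace ℝ (Fin 3))).toSphere := by
  have hmeas : MeasurableSet (ball y₀ L) := measurableSet_ball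
  have hG : Measurable fun x => (ball y₀ L).indicator F (y₀ + x) :=
    (hF.indicator hmeas).comp (measurable_const_add y₀)
  calc ∫⁻ y in ball y₀ L, F y = ∫⁻ y, (ball y₀ L).indicator F y := (lintegral_indicator hmeas F).symm
    _ = ∫⁻ x, (ball y₀ L).indicator F (y₀ + x) := (lintegral_add_left_eq_self _ y₀).symm
    _ = ∫⁻ ω : sphere (0 : EuclideanSpace ℝ (Fin 3)) 1, (∫⁻ r in Ioi (0 : ℝ),
          (ball y₀ L).indicator F (y₀ + r • (ω : EuclideanSpace ℝ (Fin 3))) * ENNReal.ofReal (r ^ 2))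
          ∂(volume : Measure (EuclideanSpace ℝ (Fin 3))).toSphere :=
        Literature.Analysis.Calculus.lintegral_eq_lintegral_sphere_Ioi _ hG
    _ = _ := by
        refine lintegral_congr fun ω => ?_
        rw [← Ioi_inter_Iio, inter_comm, ← setLIntegral_indicator measurableSet_Iio]
        refine setLIntegral_congr_fun measurableSet_Ioi fun r hr => ?_
        have hnorm : ‖r • (ω : EuclideanSpace ℝ (Fin 3))‖ = r := by
          rw [norm_smul, Real.norm_eq_abs, abs_of_pos hr, norm_eq_of_mem_sphere ω, mul_one]
        by_cases hrL : r < L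
        · have hmem : y₀ + r • (ω : EuclideanSpace ℝ (Fin 3)) ∈ ball y₀ L := by
            rw [mem_ball_iff_norm, add_sub_cancel_left, hnorm]; exact hrL
          rw [indicator_of_mem hmem, indicator_of_mem (mem_Iio.2 hrL)]
        · have hnmem : y₀ + r • (ω : EuclideanSpace ℝ (Fin 3)) ∉ ball y₀ L := by
            rw [mem_ball_iff_norm, add_sub_cancel_left, hnorm]; exact hrL
          rw [indicator_of_notMem hnmem, indicator_of_notMem (by simpa using hrL), zero_mul]

/-- `σ(S²) = 4π` for `σ = volume.toSphere` on `ℝ³` (`|S²| = 3·vol B₁`, Mathlib `Measure.toSphere_apply_univ`,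
`EuclideanSpace.volume_ball_fin_three`). [folklore] -/
theorem toSphere_volume_univ :
    (volume : Measure (EuclideanSpace ℝ (Fin 3))).toSphere univ = ENNReal.ofReal (4 * Real.pi) := by
  rw [Measure.toSphere_apply_univ, finrank_euclideanSpace, Fintype.card_fin, EuclideanSpace.volume_ball_fin_three,
    ENNReal.ofReal_one, one_pow, one_mul, show ((3 : ℕ) : ℝ≥0∞) = ENNReal.ofReal 3 by norm_num,
    ← ENNReal.ofReal_mul (by norm_num)]
  congr 1
  ring

/-! ## The radial capacity lemma -/

/-- **RADIAL CAPACITY LEMMA** (`NsregP2.R52.Provenance.RadialCapacity` VERBATIM, unfolded; class-free, symmetrization-free).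
If `V ∈ C¹`, `‖V‖ ≥ m` on `B̄(y₀, ℓ)`, `0 < m`, `0 < ℓ`, `2ℓ ≤ L`, then
`∫_{B(y₀,L)} ‖DV‖² ≥ m²·ℓ·(π − vol{y ∈ B(y₀,L) : m/2 ≤ ‖V y‖}/L³)`.
Along each direction `θ` either `‖V(y₀ + rθ)‖ ≥ m/2` for all `r ∈ [ℓ, L)` (these directions fill volume `≥ σ(Θ_bad)·(L³−ℓ³)/3 ≥ σ(Θ_bad)·L³/4`
of the level set) or `‖V‖` drops by `m/2` on `[ℓ, r_θ]`, and then `ray_energy_lower_bound` gives `∫_ℓ^L ‖DV(y₀+rθ)‖² r² dr ≥ m²ℓ/4`;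
`σ(S²) = 4π`. [nsreg-p2 R52 §D; folklore (radial length–energy)] -/
theorem radialCapacity :
    ∀ (V : EuclideanSpace ℝ (Fin 3) → EuclideanSpace ℝ (Fin 3)), ContDiff ℝ 1 V →
      ∀ (y₀ : EuclideanSpace ℝ (Fin 3)) (m ℓ L : ℝ), 0 < m → 0 < ℓ → 2 * ℓ ≤ L →
        (∀ y ∈ closedBall y₀ ℓ, m ≤ ‖V y‖) →
          m ^ 2 * ℓ * (Real.pi - (volume {y ∈ ball y₀ L | m / 2 ≤ ‖V y‖}).toReal / L ^ 3) ≤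
            ∫ y in ball y₀ L, ‖fderiv ℝ V y‖ ^ 2 := by
  intro V hV y₀ m ℓ L hm hℓ h2ℓ hcore
  have hL : 0 < L := by linarith
  have hℓL : ℓ < L := by linarith
  have hVc : Continuous V := hV.continuous
  have hDVc : Continuous (fderiv ℝ V) := hV.continuous_fderiv one_ne_zero
  set σ := (volume : Measure (EuclideanSpace ℝ (Fin 3))).toSphere with hσdef
  have hσuniv : σ univ = ENNReal.ofReal (4 * Real.pi) := toSphere_volume_univ
  have hσfin : ∀ s, σ s ≠ ⊤ := fun s =>
    ((measure_mono (subset_univ s)).trans_lt (by rw [hσuniv]; exact ENNReal.ofReal_lt_top)).ne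
  -- the bad directions: `‖V‖ ≥ m/2` along the whole radial segment `[ℓ, L)`
  set Bad : Set (sphere (0 : EuclideanSpace ℝ (Fin 3)) 1) :=
    ⋂ r ∈ Ico ℓ L, {ω | m / 2 ≤ ‖V (y₀ + r • (ω : EuclideanSpace ℝ (Fin 3)))‖} with hBad
  have hBad_closed : IsClosed Bad :=
    isClosed_biInter fun r _ => isClosed_le continuous_const (by fun_prop)
  have hBad_meas : MeasurableSet Bad := hBad_closed.measurableSet
  have hmemBad : ∀ ω, ω ∈ Bad ↔ ∀ r ∈ Ico ℓ L, m / 2 ≤ ‖V (y₀ + r • (ω : EuclideanSpace ℝ (Fin 3)))‖ := by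
    intro ω; simp only [hBad, mem_iInter, mem_setOf_eq]
  -- (E1) energy along the good directions
  set I := ∫⁻ y in ball y₀ L, ‖fderiv ℝ V y‖ₑ ^ 2 with hI
  have hFmeas : Measurable fun y => ‖fderiv ℝ V y‖ₑ ^ 2 := hDVc.measurable.enorm.pow_const 2
  have hE1 : ENNReal.ofReal (m ^ 2 * ℓ / 4) * σ Badᶜ ≤ I := by
    rw [hI, lintegral_ball_eq_lintegral_sphere _ hFmeas y₀ L, ← lintegral_indicator_const hBad_meas.compl]
    refine lintegral_mono fun ω => ?_
    by_cases hω : ω ∈ Badᶜ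
    · rw [indicator_of_mem hω]
      have hω' : ¬ ∀ r ∈ Ico ℓ L, m / 2 ≤ ‖V (y₀ + r • (ω : EuclideanSpace ℝ (Fin 3)))‖ :=
        fun h => hω ((hmemBad ω).2 h)
      push Not at hω'
      obtain ⟨r₁, hr₁, hlt⟩ := hω'
      have hω1 : ‖(ω : EuclideanSpace ℝ (Fin 3))‖ = 1 := norm_eq_of_mem_sphere ω
      have hstart : y₀ + ℓ • (ω : EuclideanSpace ℝ (Fin 3)) ∈ closedBall y₀ ℓ := by
        rw [mem_closedBall_iff_norm, add_sub_cancel_left, norm_smul, Real.norm_eq_abs, abs_of_pos hℓ, hω1, mul_one]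
      have hray := ray_energy_lower_bound hV y₀ ω hω1 hm hℓ hr₁.1 (hcore _ hstart) hlt.le
      have hcont : Continuous fun r : ℝ => ‖fderiv ℝ V (y₀ + r • (ω : EuclideanSpace ℝ (Fin 3)))‖ ^ 2 * r ^ 2 := by
        fun_prop
      calc ENNReal.ofReal (m ^ 2 * ℓ / 4)
          ≤ ENNReal.ofReal (∫ r in ℓ..r₁, ‖fderiv ℝ V (y₀ + r • (ω : EuclideanSpace ℝ (Fin 3)))‖ ^ 2 * r ^ 2) :=
            ENNReal.ofReal_le_ofReal hray
        _ = ∫⁻ r in Ioc ℓ r₁, ‖fderiv ℝ V (y₀ + r • (ω : EuclideanSpace ℝ (Fin 3)))‖ₑ ^ 2 * ENNReal.ofReal (r ^ 2) := by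
            rw [intervalIntegral.integral_of_le hr₁.1,
              ofReal_integral_eq_lintegral_ofReal (hcont.integrableOn_Icc.mono_set Ioc_subset_Icc_self)
                (ae_of_all _ fun r => mul_nonneg (sq_nonneg _) (sq_nonneg _))]
            refine setLIntegral_congr_fun measurableSet_Ioc fun r _ => ?_
            rw [ENNReal.ofReal_mul (sq_nonneg _), ← ofReal_norm, ENNReal.ofReal_pow (norm_nonneg _)]
        _ ≤ ∫⁻ r in Ioo 0 L, ‖fderiv ℝ V (y₀ + r • (ω : EuclideanSpace ℝ (Fin 3)))‖ₑ ^ 2 * ENNReal.ofReal (r ^ 2) :=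
            lintegral_mono_set fun r hr => ⟨hℓ.trans hr.1, hr.2.trans_lt hr₁.2⟩
    · rw [indicator_of_notMem hω]; exact zero_le
  -- (E2) the bad directions fill volume `≥ σ(Bad)·(L³ − ℓ³)/3` of the level set
  set S : Set (EuclideanSpace ℝ (Fin 3)) := {y | m / 2 ≤ ‖V y‖} with hS
  have hS_meas : MeasurableSet S := (isClosed_le continuous_const hVc.norm).measurableSet
  have hAeq : volume {y ∈ ball y₀ L | m / 2 ≤ ‖V y‖} = ∫⁻ y in ball y₀ L, S.indicator 1 y := by
    rw [lintegral_indicator_one hS_meas, Measure.restrict_apply hS_meas]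
    congr 1
    ext y
    simp only [hS, mem_setOf_eq, mem_inter_iff]
    tauto
  have hE2 : ENNReal.ofReal ((L ^ 3 - ℓ ^ 3) / 3) * σ Bad ≤ volume {y ∈ ball y₀ L | m / 2 ≤ ‖V y‖} := by
    rw [hAeq, lintegral_ball_eq_lintegral_sphere _ (measurable_one.indicator hS_meas) y₀ L,
      ← lintegral_indicator_const hBad_meas]
    refine lintegral_mono fun ω => ?_
    by_cases hω : ω ∈ Bad
    · rw [indicator_of_mem hω]
      have hall := (hmemBad ω).1 hω
      calc ENNReal.ofReal ((L ^ 3 - ℓ ^ 3) / 3) = ENNReal.ofReal (∫ r in ℓ..L, r ^ 2) := by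
              rw [integral_pow]; norm_num
        _ = ∫⁻ r in Ioo ℓ L, ENNReal.ofReal (r ^ 2) := by
              rw [intervalIntegral.integral_of_le hℓL.le, setLIntegral_congr Ioo_ae_eq_Ioc,
                ofReal_integral_eq_lintegral_ofReal ((continuous_pow 2).integrableOn_Icc.mono_set Ioc_subset_Icc_self)
                  (ae_of_all _ fun r => sq_nonneg r)]
        _ = ∫⁻ r in Ioo ℓ L, S.indicator 1 (y₀ + r • (ω : EuclideanSpace ℝ (Fin 3))) * ENNReal.ofReal (r ^ 2) := by
              refine setLIntegral_congr_fun measurableSet_Ioo fun r hr => ?_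
              have hmem : y₀ + r • (ω : EuclideanSpace ℝ (Fin 3)) ∈ S := hall r ⟨hr.1.le, hr.2⟩
              rw [indicator_of_mem hmem, Pi.one_apply, one_mul]
        _ ≤ ∫⁻ r in Ioo 0 L, S.indicator 1 (y₀ + r • (ω : EuclideanSpace ℝ (Fin 3))) * ENNReal.ofReal (r ^ 2) :=
              lintegral_mono_set (Ioo_subset_Ioo_left hℓ.le)
    · rw [indicator_of_notMem hω]; exact zero_le
  -- finiteness
  have hI_fin : I ≠ ⊤ := by
    have hc : Continuous fun y => ‖fderiv ℝ V y‖₊ ^ 2 := hDVc.nnnorm.pow 2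
    have h1 : I ≤ ∫⁻ y in closedBall y₀ L, ((‖fderiv ℝ V y‖₊ ^ 2 : NNReal) : ℝ≥0∞) := by
      refine (lintegral_mono_set ball_subset_closedBall).trans (le_of_eq ?_)
      refine lintegral_congr fun y => ?_
      rw [ENNReal.coe_pow]
      rfl
    exact ne_top_of_le_ne_top
      (setLIntegral_lt_top_of_isCompact measure_closedBall_lt_top.ne (isCompact_closedBall _ _) hc).ne h1
  have hA_fin : volume {y ∈ ball y₀ L | m / 2 ≤ ‖V y‖} ≠ ⊤ :=
    ((measure_mono fun y hy => hy.1).trans_lt measure_ball_lt_top).ne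
  -- the left-hand side as `I.toReal`
  have hint : ∫ y in ball y₀ L, ‖fderiv ℝ V y‖ ^ 2 = I.toReal := by
    have hsm : AEStronglyMeasurable (fun y => ‖fderiv ℝ V y‖ ^ 2) (volume.restrict (ball y₀ L)) :=
      (Continuous.aestronglyMeasurable (by fun_prop))
    rw [integral_eq_lintegral_of_nonneg_ae (ae_of_all _ fun y => sq_nonneg _) hsm]
    congr 1
    refine lintegral_congr fun y => ?_
    rw [← ofReal_norm, ENNReal.ofReal_pow (norm_nonneg _)]
  -- pass to real numbers
  have hsum : σ Badᶜ + σ Bad = ENNReal.ofReal (4 * Real.pi) := by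
    rw [add_comm, measure_add_measure_compl hBad_meas, hσuniv]
  have hgb : (σ Badᶜ).toReal + (σ Bad).toReal = 4 * Real.pi := by
    have := congrArg ENNReal.toReal hsum
    rwa [ENNReal.toReal_add (hσfin _) (hσfin _), ENNReal.toReal_ofReal (by positivity)] at this
  have h1 : m ^ 2 * ℓ / 4 * (σ Badᶜ).toReal ≤ I.toReal := by
    have := ENNReal.toReal_mono hI_fin hE1
    rwa [ENNReal.toReal_mul, ENNReal.toReal_ofReal (by positivity)] at this
  have hℓ3 : 8 * ℓ ^ 3 ≤ L ^ 3 := by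
    have h : (2 * ℓ) ^ 3 ≤ L ^ 3 := by gcongr
    linarith [show (2 * ℓ) ^ 3 = 8 * ℓ ^ 3 by ring]
  have hℓ3' : 0 ≤ (L ^ 3 - ℓ ^ 3) / 3 := by
    have : 0 < ℓ ^ 3 := by positivity
    have : 0 ≤ L ^ 3 - ℓ ^ 3 := by linarith
    positivity
  have h2 : (L ^ 3 - ℓ ^ 3) / 3 * (σ Bad).toReal ≤ (volume {y ∈ ball y₀ L | m / 2 ≤ ‖V y‖}).toReal := by
    have := ENNReal.toReal_mono hA_fin hE2
    rwa [ENNReal.toReal_mul, ENNReal.toReal_ofReal hℓ3'] at this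
  have hb0 : 0 ≤ (σ Bad).toReal := ENNReal.toReal_nonneg
  set v := (volume {y ∈ ball y₀ L | m / 2 ≤ ‖V y‖}).toReal with hv
  have hL3 : 0 < L ^ 3 := by positivity
  have hbv : (σ Bad).toReal / 4 ≤ v / L ^ 3 := by
    rw [div_le_div_iff₀ (by norm_num) hL3]
    nlinarith
  rw [hint]
  have hml0 : 0 ≤ m ^ 2 * ℓ := by positivity
  calc m ^ 2 * ℓ * (Real.pi - v / L ^ 3) ≤ m ^ 2 * ℓ * (Real.pi - (σ Bad).toReal / 4) := by
        gcongr
    _ = m ^ 2 * ℓ / 4 * (σ Badᶜ).toReal := by rw [show (σ Badᶜ).toReal = 4 * Real.pi - (σ Bad).toReal by linarith]; ring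
    _ ≤ ENNReal.toReal I := h1

end Capacity

end Summit.NavierStokesRegularity.NavierStokesRegularity.Theorems.PowerGaugeEulerLiouville

end
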